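import Mathlib
import HarnessLib
import Summits.HubbardSuperconductivity.HubbardSuperconductivity.Theorems.KLProgrammeKLRegimeEnginePairTransferBaseScaleZeroData
import Summits.HubbardSuperconductivity.HubbardSuperconductivity.Theorems.KLProgrammeKLRegimeEnginePairTransferBaseSecondOrderClosed

/-!
# Route `KLProgramme` — ENGINE item stmt-HubbardSuperconductivity-20437 `KLRegimeEngineV17F2`, class #5 BASE, located items «(X).2′-BASE-ROOM» / «SCALE0-MEMBER-DIFF»:
# THE BASE EXISTENTIAL FROM THE SECOND-ORDER ROW — **`klmf_baseData_of_scaleZero_v2`**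
# (cell gate-hubbard-kl, seat hubbard-kl-k3c1-p1 g23; v2 of k3c1-p1 g14's `klmf_baseData_of_scaleZero`, cure (β)/(β″) of «(X).2′-BASE-ROOM»)

WHY.  `klmf_baseData_of_scaleZero` (✓, `…BaseScaleZeroData`) produces the BASE existential of the class-#5 one-call from the two a priori member rows and ONE scalar inequality
`(4/6047)·klIdxMass 0 j′·(klTransferC R·U²) + 4·mA²·klIdxMass 0 j′ ≤ θ·r·(Klam U)²·klIdxMass 0 j′`, which is `U`-homogeneous and, `klTransferC R ≥ 2¹⁰²` (✓ p731331), NOT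
dischargeable inside the cap `r ≤ klCTcap8` uniformly in `P` (located «(X).2′-BASE-ROOM»).  With the ORDER SPLIT of `…PairTransferBaseSecondOrder(Closed)` (✓ p732881/p732926:
`‖(𝒜₀[s_j] − 𝒜₀[s_{j′}]) − (E₂[s_j] − E₂[s_{j′}])‖ ≤ (56/(5·6047))·klIdxMass 0 j′·klTransferC R·klScaleZeroThetaC R·U³`) the member difference is its EXPLICIT SECOND-ORDER
part `E₂[s_j] − E₂[s_{j′}]` (`E₂[ψ] = 𝒱₄(map S (e^{Δ_{SᵀS_ψS}} T₂))(pairLegs Q k k′)`, `T₂ = −(2!)⁻¹·𝓔ᵀ_{C′}(−Ṽ;2)`) plus an `O(U³)` remainder, so the BASE existential follows from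
* the two a priori rows (as before; theorems by `klmx_memberArray_zero_le` once `U + (klScaleZeroValC R + klTransferC R)·U² ≤ mA`),
* ONE second-order row `∀ k k′ ∈ ball, ‖E₂[s_j] − E₂[s_{j′}]‖(Q;k,k′) ≤ X₂·klIdxMass 0 j′·U²` with a free size `X₂` (scope (L4): the one-loop bubble with a `D`-line, momentum
  space, paper `X₂ ≈ 18` — a TRUE statement with a small constant, to be proved by the scale-0 lane; here a HYPOTHESIS), and
* the scalar inequality `(X₂·U² + (56/(5·6047))·klTransferC R·klScaleZeroThetaC R·U³)·klIdxMass 0 j′ + 4·mA²·klIdxMass 0 j′ ≤ θ·r·(Klam U)²·klIdxMass 0 j′` — NO LONGER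
  `U`-homogeneous in its tree-constant part: dischargeable with `r ≥ (X₂ + 4(mA/U)²)/(θ·Klam²)·(1+ε)` inside the cap and `U ≤ U₀(R)`.
* **`klmf_baseData_of_scaleZero_v2 … hA₁ hA₂ hE hbud`** ⊢ the SAME existential as `klmf_baseData_of_scaleZero` (so the spine's BASE branch re-keys by swapping one call).
Composition of landed theorems; nothing about the model's sizes is asserted (the second-order row and the scalar row are hypotheses); nothing asserts (X), any stub, K3, U₀,
the window or superconductivity.  0 kit · 0 lit.  References: BGM 2006 §2.4, (2.77)–(2.80) [cite: BenfattoGiulianiMastropietro2006].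
-/

noncomputable section

namespace Summit.HubbardSuperconductivity.HubbardSuperconductivity.Theorems.KLRegimeSplit

set_option linter.dupNamespace false -- summit = problem name (single-conjunct summit), D-0017

open Real Finset Matrix Set Literature.MathematicalPhysics.QuantumLattice Literature.Probability.LatticeModels GrassmannAlgebra
open Summit.HubbardSuperconductivity.HubbardSuperconductivity.Theorems.KLProgrammeCooperResummation
open Summit.HubbardSuperconductivity.HubbardSuperconductivity.Theorems.KLProgrammeLegKernels
open Summit.HubbardSuperconductivity.HubbardSuperconductivity.Theorems.DispersionFlow
open Summit.HubbardSuperconductivity.HubbardSuperconductivity.Theorems.KLRegimeWick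
open Summit.HubbardSuperconductivity.HubbardSuperconductivity.Theorems.EngineV8
open Summit.HubbardSuperconductivity.HubbardSuperconductivity.Theorems.ScaleZeroDecay

section Base

variable (L M : ℕ) [NeZero L] [NeZero M]

/-- **`klmf_baseData_of_scaleZero_v2`** — the BASE existential of the class-#5 one-call at the bar `θ·transferBarRelIdx L G P r β U 0 j′`, from the two a priori rows, the
SECOND-ORDER row `‖E₂[s_{0,j}] − E₂[s_{0,j′}]‖ ≤ X₂·klIdxMass 0 j′·U²` on the bare ball and the scalar inequality
`(X₂·U² + (56/(5·6047))·klTransferC R·klScaleZeroThetaC R·U³)·klIdxMass 0 j′ + 4·mA²·klIdxMass 0 j′ ≤ θ·r·(Klam U)²·klIdxMass 0 j′` (the `O(U³)` remainder is the theorem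
`klso_memberDiff_sub_second_le_cube`). -/
theorem klmf_baseData_of_scaleZero_v2 {R : RenConsts} (hRw : R.WF) {N₀ : ℕ} {G : GeoConsts} (hCF : 0 ≤ G.CF) {P : SplitConsts} (hKl : 0 ≤ P.Klam) {r : ℝ} (hr : 0 ≤ r)
    {β U μ : ℝ} (hU : 0 < U) (hU1 : U ≤ 1) {mA θ : ℝ} (hm : 0 ≤ mA) (hθ0 : 0 ≤ θ)
    (hKf : FrameOK R U N₀ μ (klFlowFrameU L M β U μ 0)) (hβ : klBetaMin ≤ β) (hβL : β ≤ L) (hβM : β ^ 3 ≤ (M : ℝ)) (hθC : klScaleZeroThetaC R * U ≤ 1 / 4)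
    (T₂ : GrassmannAlgebra ℂ (GridLeg (GridPoint L (2 * (2 * M)))))
    (hT₂ : T₂ = -((((2 : ℕ).factorial : ℕ) : ℂ)⁻¹ •
      ((cumulantOf (fun k => evenGaussConv ℂ ((hubbardGridSub L M β (2 * (2 * M))).transpose * hubbardCovAboveCT L M β μ 0 (klFlowFrameU L M β U μ 0) klE0 *
          hubbardGridSub L M β (2 * (2 * M)))
        ((⟨-(hubbardGridInteraction L (2 * (2 * M)) β U + hubbardGridCounterQuadratic L (2 * (2 * M)) β (klFlowFrameU L M β U μ 0)),
          neg_mem (add_mem (hubbardGridInteraction_mem_evenPart β U) (hubbardGridCounterQuadratic_mem_evenPart β (klFlowFrameU L M β U μ 0)))⟩ :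
            evenPart ℂ (GridLeg (GridPoint L (2 * (2 * M))))) ^ k)) 2 : evenPart ℂ (GridLeg (GridPoint L (2 * (2 * M))))) :
              GrassmannAlgebra ℂ (GridLeg (GridPoint L (2 * (2 * M)))))))
    {j j' : ℕ} (hj : j' ≤ j) (Qm : TorusSite 2 L)
    (hA₁ : ∀ x y, ‖klMemberArrayF L M β U μ 0 (softSymbolCompl L M β μ (klFlowFrameU L M β U μ 0) 0 j) Qm x y‖ ≤ mA)
    (hA₂ : ∀ x y, ‖klMemberArrayF L M β U μ 0 (softSymbolCompl L M β μ (klFlowFrameU L M β U μ 0) 0 j') Qm x y‖ ≤ mA)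
    {X₂ : ℝ}
    (hE : ∀ k ∈ klBall L μ 0, ∀ k' ∈ klBall L μ 0,
      ‖vertexFn L M β (ExteriorAlgebra.map (Matrix.toLin' (hubbardGridSub L M β (2 * (2 * M))))
            (gaussConv ℂ ((hubbardGridSub L M β (2 * (2 * M))).transpose * softCovOf L M β μ (klFlowFrameU L M β U μ 0) (softSymbolCompl L M β μ (klFlowFrameU L M β U μ 0) 0 j) *
              hubbardGridSub L M β (2 * (2 * M))) T₂)) 4 (pairLegs L M Qm k k') -
          vertexFn L M β (ExteriorAlgebra.map (Matrix.toLin' (hubbardGridSub L M β (2 * (2 * M))))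
            (gaussConv ℂ ((hubbardGridSub L M β (2 * (2 * M))).transpose * softCovOf L M β μ (klFlowFrameU L M β U μ 0) (softSymbolCompl L M β μ (klFlowFrameU L M β U μ 0) 0 j') *
              hubbardGridSub L M β (2 * (2 * M))) T₂)) 4 (pairLegs L M Qm k k')‖ ≤ X₂ * klIdxMass 0 j' * U ^ 2)
    (hbud : (X₂ * U ^ 2 + 56 / (5 * 6047) * (klTransferC R * klScaleZeroThetaC R * U ^ 3)) * klIdxMass 0 j' + 4 * (mA * mA) * klIdxMass 0 j' ≤
      θ * (r * ((P.Klam * U) ^ 2 * klIdxMass 0 j'))) :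
    ∃ η : TorusSite 2 L → TorusSite 2 L → ℝ,
      (∀ x y, ‖klMemberArrayF L M β U μ 0 (softSymbolCompl L M β μ (klFlowFrameU L M β U μ 0) 0 j) Qm x y‖ ≤ mA) ∧
      (∀ x y, ‖klMemberArrayF L M β U μ 0 (softSymbolCompl L M β μ (klFlowFrameU L M β U μ 0) 0 j') Qm x y‖ ≤ mA) ∧
      (∀ k ∈ klBall L μ 0, ∀ k' ∈ klBall L μ 0,
        ‖(klMemberArrayF L M β U μ 0 (softSymbolCompl L M β μ (klFlowFrameU L M β U μ 0) 0 j) Qm - klMemberArrayF L M β U μ 0 (softSymbolCompl L M β μ (klFlowFrameU L M β U μ 0) 0 j') Qm) k k'‖ ≤ η k k') ∧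
      (∀ k ∈ klBall L μ 0, ∀ k' ∈ klBall L μ 0, η k k' + mA * mA *
        ∑ c, ‖(-(((klTransferWeight L M β μ (klFlowFrameU L M β U μ 0) 0 (softSymbolCompl L M β μ (klFlowFrameU L M β U μ 0) 0 j) Qm c -
          klTransferWeight L M β μ (klFlowFrameU L M β U μ 0) 0 (softSymbolCompl L M β μ (klFlowFrameU L M β U μ 0) 0 j') Qm c : ℝ)) : ℂ))‖ ≤
        θ * transferBarRelIdx L G P r β U 0 j' Qm k k') := by
  refine ⟨fun _ _ => (X₂ * U ^ 2 + 56 / (5 * 6047) * (klTransferC R * klScaleZeroThetaC R * U ^ 3)) * klIdxMass 0 j', hA₁, hA₂, fun k hk k' hk' => ?_,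
    fun k hk k' hk' => ?_⟩
  · -- member difference = explicit second order (row `hE`) + `O(U³)` remainder (`klso_memberDiff_sub_second_le_cube`)
    rw [Matrix.sub_apply, klMemberArrayF_apply_of_mem β U μ 0 _ Qm hk hk', klMemberArrayF_apply_of_mem β U μ 0 _ Qm hk hk']
    have hrem := klso_memberDiff_sub_second_le_cube (L := L) (M := M) hRw hU hU1 hKf hβ hβL hβM hθC T₂ hT₂ hj Qm k k'
    have h2 := hE k hk k' hk'
    have htri := norm_sub_le_norm_sub_add_norm_sub
      (klCovSmearedPairAmplitude L M β U μ (klFlowFrameU L M β U μ 0) 0 (softCovOf L M β μ (klFlowFrameU L M β U μ 0) (softSymbolCompl L M β μ (klFlowFrameU L M β U μ 0) 0 j)) Qm k k' -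
        klCovSmearedPairAmplitude L M β U μ (klFlowFrameU L M β U μ 0) 0 (softCovOf L M β μ (klFlowFrameU L M β U μ 0) (softSymbolCompl L M β μ (klFlowFrameU L M β U μ 0) 0 j')) Qm k k')
      (vertexFn L M β (ExteriorAlgebra.map (Matrix.toLin' (hubbardGridSub L M β (2 * (2 * M))))
            (gaussConv ℂ ((hubbardGridSub L M β (2 * (2 * M))).transpose * softCovOf L M β μ (klFlowFrameU L M β U μ 0) (softSymbolCompl L M β μ (klFlowFrameU L M β U μ 0) 0 j) *
              hubbardGridSub L M β (2 * (2 * M))) T₂)) 4 (pairLegs L M Qm k k') -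
          vertexFn L M β (ExteriorAlgebra.map (Matrix.toLin' (hubbardGridSub L M β (2 * (2 * M))))
            (gaussConv ℂ ((hubbardGridSub L M β (2 * (2 * M))).transpose * softCovOf L M β μ (klFlowFrameU L M β U μ 0) (softSymbolCompl L M β μ (klFlowFrameU L M β U μ 0) 0 j') *
              hubbardGridSub L M β (2 * (2 * M))) T₂)) 4 (pairLegs L M Qm k k'))
      0
    rw [sub_zero, sub_zero] at htri
    have hms : 0 ≤ klIdxMass 0 j' := klIdxMass_nonneg 0 j'
    nlinarith [htri, hrem, h2]
  · have hw : ∑ c, ‖(-(((klTransferWeight L M β μ (klFlowFrameU L M β U μ 0) 0 (softSymbolCompl L M β μ (klFlowFrameU L M β U μ 0) 0 j) Qm c -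
          klTransferWeight L M β μ (klFlowFrameU L M β U μ 0) 0 (softSymbolCompl L M β μ (klFlowFrameU L M β U μ 0) 0 j') Qm c : ℝ)) : ℂ))‖ ≤ 4 * klIdxMass 0 j' := by
      have h := sum_abs_klTransferWeight_compl_sub_le (M := M) β μ (klFlowFrameU L M β U μ 0) hKf hβ hβL (Nat.zero_le j') hj Qm
      refine le_of_eq_of_le ?_ h
      refine Finset.sum_congr rfl fun c _ => ?_
      rw [norm_neg, Complex.norm_real, Real.norm_eq_abs]
    have hfl := transferBarRelIdx_floor_le (L := L) hCF hKl hr β U 0 j' Qm k k'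
    rw [klIdxPrefactor_zero, pow_zero, inv_one, one_mul] at hfl
    have hmm : 0 ≤ mA * mA := mul_nonneg hm hm
    have h1 := mul_le_mul_of_nonneg_left hw hmm
    have h2 := mul_le_mul_of_nonneg_left hfl hθ0
    linarith

end Base

end Summit.HubbardSuperconductivity.HubbardSuperconductivity.Theorems.KLRegimeSplit

end
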